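import Summits.BirchSwinnertonDyer.Rank1Residual.Partition.MainConjecturesCoveredAllPrimesJSW
import Summits.BirchSwinnertonDyer.Rank1Residual.Partition.MainConjecturesIrreducibleBDP
import HarnessLib

/-!
# `Covered ⟹ BSD_p` at EVERY prime with the anticyclotomic main conjecture PUBLISHED at `p > 3`:
# the all-primes capstone with `hLA` discharged by BCS 2025 Thm. 1.2.4 (b) ∘ CGLS 2022 Thm. 5.1.3

HONEST FRAMING (cell `b2b-bsdres`, run/shared/lean/b2b/bsd-rank1-residual/; page 1 of every file):
the goal is to DELETE the COMBINATION-SHAPED residual classes — to produce a Lean theorem "BSD_p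
formula for every rank `≤ 1` curve in class `C`" assembled STRICTLY from published theorems — so
that the remainder becomes exactly the CONSTRUCTION-SHAPED classes, which are TYPED, not attempted;
this is not "finishing BSD". Every published theorem enters as one of the tree's existing named
Literature facts `(h : <Fact>)` (a `def … : Prop` vendored with its cite, D-0014; nothing asserted, no
new fact, no `sorry`). Unit `b2b-bsdres-lit-glue` (GLUE seat), gen 6, File H.

## What this file does

`bsdp_of_covered_of_mainConjectures_allPrimes_of_thm331` (File D, this gen) is the partition's
consequence form `Covered W p → BSDp W p` at every prime with every covered row at main-conjecture
level, whose typed inputs were: `hLA` ((IMC≥∘BDP)ᵍ in the JSW letter, keyed `GoodOrd → Irr → Surj →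
r_an = 1 → p ∤ ∏c_ℓ`, consumed by rows C2 (`p > 3`), C3-ordinary (`p ≥ 3`), C16 (`p = 3`)), `hKMC`
(Kobayashi's signed MC on C3-ss), `hIrrK` ((irr_K) at the Heegner fields), `htam`, and the two final
statements `hCM`/`hLLT`. With this gen's Literature fact
`BurungaleCastellaSkinner2025.thm124b_thm513_generator_constantCoeff` (BCS 2025 Thm. 1.2.4 (b) at `𝟙` ∘
CGLS 2022 Thm. 5.1.3) and the σ-bridge of `Partition/MainConjecturesIrreducibleBDP.lean`
(`X11b.imcLowerWaldspurgerOnTreeGoodAt_inducedPlace_of_heegner_of_thm124b_of_thm331`), `hLA` is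
DISCHARGED at every `p > 3`; what remains typed of it is its restriction `hLAle3` to `p ≤ 3` (consumed
only at `p = 3`: rows C3-ordinary@3 and C16, where the printed anticyclotomic IMC is Yan–Zhu 2026
Thm. 4.12, not yet a composite Literature fact; at `p = 2` the keys `GoodOrd ∧ Irr ∧ Surj` are not
excluded by the binder but no row consumes it).

* `bsdp_of_covered_of_mainConjectures_allPrimes_of_thm331_of_thm124b` — the capstone: main
  conjectures as PUBLISHED named facts in EVERY column where print exists on the tree's objects
  (S–U 3.6.9, Skinner Thm. A, BCS 1.1.2 (b), Yan–Zhu 4.9, CGS Thm. A + CGLS (5.5), GV 1.3, Rubin 12.3,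
  Pollack–Rubin; anticyclotomic: BCS 1.2.4 (b) ∘ BDP + JSW 3.3.1), typed ONLY: `hLAle3` (p = 3
  anticyclotomic IMC), `hKMC` (signed MC on C3-ss — OPEN in print off CM / `a_p = 0`), `hIrrK`, `htam`,
  and the final statements `hCM` (Rubin 11.1 / BF24: CM r = 0 at p = 2 or bad p), `hLLT` (LLT 2024).

References: [BurungaleCastellaSkinner2025] Thm. 1.1.2 (b), 1.2.4 (b), Cor. 1.3.1; [JetchevSkinnerWan2017]
Thm. 3.3.1; [CastellaGrossiLeeSkinner2022] Thm. 5.1.3; the module docstrings of Files D and G;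
HOME/b2b-bsdres-lit-glue/GLUE.md GEN 6 ADDENDUM.
-/

set_option autoImplicit false

noncomputable section

open scoped Classical

open CongruenceSubgroup WeierstrassCurve NumberField IsDedekindDomain
  Literature.NumberTheory.EllipticCurves Literature.NumberTheory.Automorphic
  Literature.NumberTheory.EllipticCurves.ModularForms
  Literature.NumberTheory.EllipticCurves.Rank1Residual
  Literature.NumberTheory.EllipticCurves.Rank1Residual.Typed
  Literature.NumberTheory.EllipticCurves.CastellaGrossiLeeSkinner2022
  Literature.NumberTheory.EllipticCurves.BurungaleCastellaSkinner2025
  Literature.NumberTheory.EllipticCurves.YanZhu2026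
  Literature.NumberTheory.EllipticCurves.Skinner2016
  Literature.NumberTheory.EllipticCurves.SteinWuthrich2013
  Literature.NumberTheory.EllipticCurves.Kobayashi2003
  Literature.NumberTheory.EllipticCurves.BurungaleKobayashiOta2024
  Literature.NumberTheory.EllipticCurves.PollackRubin2004 ZpExtension
  Literature.NumberTheory.EllipticCurves.JetchevSkinnerWan2017
  Summit.BirchSwinnertonDyer.BirchSwinnertonDyer.Theorems.Rank1ResidualX1Defs

namespace Summit.BirchSwinnertonDyer.Rank1Residual

/-- **`Covered ⟹ BSD_p` at EVERY prime, anticyclotomic main conjecture PUBLISHED at `p > 3`.** File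
D's `bsdp_of_covered_of_mainConjectures_allPrimes_of_thm331` with `hLA` fed, at every `p > 3`, by
BCS 2025 Thm. 1.2.4 (b) ∘ CGLS 2022 Thm. 5.1.3 (`h124`) through the σ-bridge
(`X11b.imcLowerWaldspurgerOnTreeGoodAt_inducedPlace_of_heegner_of_thm124b_of_thm331`: rank one and
finite `Ш` over `K` by Kolyvagin from the non-torsion Heegner point, (irr_K) from `hIrrK`); at `p ≤ 3`
the typed `hLAle3` remains (Yan–Zhu 2026 Thm. 4.12 in print at `p = 3`).
[cite: BurungaleCastellaSkinner2025, Thm. 1.1.2 (b), Thm. 1.2.4 (b), Cor. 1.3.1 and its proof (p. 4)]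
[cite: JetchevSkinnerWan2017, Thm. 3.3.1] [cite: CastellaGrossiLeeSkinner2022, Thm. 5.1.3]
[cite: YanZhu2024MainConjNonCM, Thm. 4.9, Thm. 4.12] -/
theorem bsdp_of_covered_of_mainConjectures_allPrimes_of_thm331_of_thm124b
    -- main conjectures: PUBLISHED named facts
    (hSU : ∀ (W : WeierstrassCurve ℚ) [W.IsElliptic] [W.IsGloballyMinimal] (p : ℕ) [Fact p.Prime]
      (κ : ZpExtension ℚ p) (γ : Field.absoluteGaloisGroup ℚ) (N : ℕ) [NeZero N]
      (f : CuspForm (Gamma0 N) 2),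
      skinner_urban_main_conjecture W p (κ := κ) (γ := γ) (f := f))
    (hA : thmA_charIdeal_multiplicative)
    (hBCS : thm112b_charIdeal_eq_padicLFunction_integral)
    (hYZ : thm49_charIdeal_eq_padicLFunction_integral)
    (hCGSA : CastellaGrossiSkinner2025.thmA_charIdeal_eq_padicLFunction)
    (h55 : display55_sha_heegnerIndex)
    (hGV : GreenbergVatsal2000.thm13_charIdeal_eq_of_gvPar)
    (hRu : Rubin1991.thm123_charIdeal_eq_padicLFunction_of_cm)
    (hPR : PollackRubin2004.mainTheorem_signedCharIdeal_eq_of_cm)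
    -- control / leading-term / link theorems: PUBLISHED named facts
    (h331 : thm331_anticyclotomicControl) (h124 : thm124b_thm513_generator_constantCoeff)
    (hGr : greenberg_charValue_rankZero)
    (hJs : thm61_splitMultiplicative) (hJn : thm61_nonsplitMultiplicative)
    (hGS : ∀ (W : WeierstrassCurve ℚ) [W.IsElliptic] [W.IsGloballyMinimal] (p : ℕ) [Fact p.Prime],
      greenberg_stevens (W := W) (p := p))
    (h5 : realPeriodRat_eq_unit_mul_plusPeriod) (h3 : realPeriodRat_eq_unit_mul_plusPeriod_three)
    (hSo : Schneider1985_order_charGenerator_odd) (hPRo : perrinRiou_rankOne_leadingTerms_odd)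
    (hMT : mazur_tate_sigma_exists_odd) (hBerO : bertrand_pairing_self_ne_zero_of_hasCM_odd)
    (h12 : Kobayashi2003.thm12_signedSelmerDual_finite_torsion)
    (hKim : BDKim2013.cor315_signedCharValue_rankZero)
    (hA5 : corA5_pPart_of_signedCharIdeal_eq)
    (hW20 : Wuthrich2014.lemma20_surjective_threeAdic_of_semistable)
    (hGZQ : GrossZagier1986_thm_I_7_3)
    (hGZ : ∀ (N : ℕ) [NeZero N] (W : WeierstrassCurve ℚ) (K : Type) [Field K] [NumberField K],
      gross_zagier N W K)
    (hKo : ∀ (N : ℕ) [NeZero N] (W : WeierstrassCurve ℚ) (K : Type) [Field K] [NumberField K],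
      kolyvagin N W K)
    (hB : ∀ (N : ℕ) [NeZero N] (W : WeierstrassCurve ℚ) (K : Type) [Field K] [NumberField K],
      Kolyvagin1990_padicValNat_card_sha_le N W K)
    (hHL : HoffsteinLuo1997_exists_twist_L_one_ne_zero)
    (hMaz : mazur_not_dvd_maninConstant_of_odd) (hNS : integral_neronScaling_of_isGloballyMinimal)
    (hCassels : bsdRHS_eq_of_isIsogenous) (hLL : diamond1995_refinedSerre)
    -- the two final statements (CM rows off the good odd locus)
    (hCM : bsdTriple_of_hasCM_of_L_one_ne_zero) (hLLT : LiLiuTian2024.thm11_bsdp_of_cm_rank_one)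
    -- modularity, GZK
    (hmod : hasEntireLFunction_rat) (hmodP : nonempty_modularParametrizationData)
    (hnf : exists_isNewformOf) (hGZK : rank_eq_analyticRank_of_analyticRank_le_one)
    -- (irred_K) at the Heegner fields of the irreducible rank-one pairs — JSW's hypothesis, TYPED
    (hIrrK : ∀ (W : WeierstrassCurve ℚ) [W.IsElliptic] [W.IsGloballyMinimal] (p : ℕ) [Fact p.Prime],
      GoodOrd W p → Irr W p → Surj W p → W.analyticRank = 1 → ¬ p ∣ W.tamagawaProduct →
      ∀ (K : Type) [Field K] [NumberField K], IsImaginaryQuadratic K →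
        SatisfiesHeegnerHypothesis (W.conductorNorm ℤ) K → SatisfiesHeegnerHypothesis p K →
        (W.baseChange K).HasIrreducibleModPGaloisRep p)
    -- (IMC≥∘BDP)ᵍ AS TYPED on the constructed `X_ac`, JSW/Castella convention — ONLY at `p ≤ 3` now
    (hLAle3 : ∀ (W : WeierstrassCurve ℚ) [W.IsElliptic] [W.IsGloballyMinimal] (p : ℕ) [Fact p.Prime]
      (N : ℕ) [NeZero N] (K : Type) [Field K] [NumberField K]
      (Dt : ModularParametrizationData W N) (H : HeegnerDatum N (NumberField.discr K)) (ι : K →+* ℂ)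
      (P : (W.baseChange K).toAffine.Point),
      p ≤ 3 → GoodOrd W p → Irr W p → Surj W p → W.analyticRank = 1 → ¬ p ∣ W.tamagawaProduct →
      W.conductorNorm ℤ = N → IsImaginaryQuadratic K → Odd (NumberField.discr K) →
      NumberField.discr K < -4 → SatisfiesHeegnerHypothesis N K → SatisfiesHeegnerHypothesis p K →
      (W.quadraticTwist (NumberField.discr K : ℚ)).entireLFunction 1 ≠ 0 →
      WeierstrassCurve.Affine.Point.map ι.toRatAlgHom P = heegnerPointComplex Dt H →
      ¬ (p : ℤ) ∣ Dt.c → ¬ IsOfFinAddOrder P →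
      ∀ (κ : ZpExtension K p), κ.IsAnticyclotomic →
        ∀ (γ : Field.absoluteGaloisGroup K) [Fact (κ.IsTopGenerator γ)] (ιp : K →+* ℚ_[p]),
          X11b.IMCLowerWaldspurgerOnTreeGoodAt p κ (X11b.inducedPlace ιp) γ ιp P)
    -- the pair
    (W : WeierstrassCurve ℚ) [W.IsElliptic] [W.IsGloballyMinimal] (p : ℕ) [Fact p.Prime]
    (hr : W.analyticRank ≤ 1)
    (hPollack : ∀ {N : ℕ} [NeZero N] {f : CuspForm (Gamma0 N) 2},
      pollack_exists_plusMinusPAdicLFunction (W := W) (f := f) (p := p))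
    (ε : ℤˣ)
    (hKMC : RowC3 W p → (p : ℤ) ∣ W.frobeniusTrace p → Supersingular.KobayashiMainConjecture W p ε)
    (htam : W.analyticRank = 1 → Irr W p → Surj W p → ¬ p ∣ W.tamagawaProduct)
    (h : Covered W p) : BSDp W p := by
  refine bsdp_of_covered_of_mainConjectures_allPrimes_of_thm331 hSU hA hBCS hYZ hCGSA h55 hGV hRu hPR
    h331 hGr hJs hJn hGS h5 h3 hSo hPRo hMT hBerO h12 hKim hA5 hW20 hGZQ hGZ hKo hB hHL hMaz hNS hCassels
    hLL hCM hLLT hmod hmodP hnf hGZK hIrrK ?_ W p hr hPollack ε hKMC htam h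
  intro V _ _ q _ N _ K _ _ Dt H ι P hord hirr hsurj hr1 htamV hN hK hodd hlt hHN hHq hLt hP hc hPinf κ
    hκ γ _ ιp
  by_cases hq : 3 < q
  · have hHN' : SatisfiesHeegnerHypothesis (V.conductorNorm ℤ) K := by rw [hN]; exact hHN
    exact X11b.imcLowerWaldspurgerOnTreeGoodAt_inducedPlace_of_heegner_of_thm124b_of_thm331 V q N K Dt
      H ι P h124 h331 (hKo N V K) hq hord hsurj (hIrrK V q hord hirr hsurj hr1 htamV K hK hHN' hHq) hN hK
      hodd hlt hHN hHq hP hc hPinf hκ ιp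
  · exact hLAle3 V q N K Dt H ι P (by omega) hord hirr hsurj hr1 htamV hN hK hodd hlt hHN hHq hLt hP hc
      hPinf κ hκ γ ιp

end Summit.BirchSwinnertonDyer.Rank1Residual

end
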